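import Summits.AnomalousDissipation.AnomalousDissipation.Theses.EulerLimit
import Literature.Analysis.FunctionSpaces.TorusTimePeriodicLift
import Literature.Analysis.FunctionSpaces.TorusSpaceTimeL3Cauchy
import Literature.Analysis.FunctionSpaces.DiagonalWeakLimits
import Literature.Analysis.FunctionSpaces.TorusTimePeriodization
import Literature.Analysis.FunctionSpaces.EquicontinuousSubsequence

/-!
# Stub-ideation sketch (ideator 2, FAMILY 2 — RESHAPE) for `stub_kolmogorovRieszPeriodicSlab`

Helper-lemma SIGNATURES only (elaboration check; every proof is `sorry`).  See
`STUB-IDEAS-stub_kolmogorovRieszPeriodicSlab-2.md` for the plans.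
-/

noncomputable section

set_option linter.dupNamespace false

open Filter Set MeasureTheory Function Metric
open scoped ENNReal Topology

namespace Summit.AnomalousDissipation.AnomalousDissipation.Cruxes.EulerlimitThesisV2.Tight.StubIdeas2

open Literature.Analysis.FunctionSpaces

local notation "𝕋³" => UnitAddTorus (Fin 3)
local notation "E³" => EuclideanSpace ℝ (Fin 3)

/-! ## Plan 1 — ROLL TIME ONTO A FOURTH CIRCLE: the stub is Kolmogorov–Riesz on the compact group `T⁴` -/

/-- **H1 (roll-up dictionary, measure).** Haar integral on `T^{1+n}` = `τ⁻¹ ×` slab integral. -/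
theorem lintegral_torus_succ_eq_slab {n : ℕ} {τ : ℝ} (hτ : 0 < τ)
    (G : UnitAddTorus (Fin (n + 1)) → ℝ≥0∞) (hG : Measurable G) :
    ∫⁻ y, G y = ENNReal.ofReal τ⁻¹ *
      ∫⁻ t in Ioo 0 τ, ∫⁻ x : UnitAddTorus (Fin n), G (Fin.cons ((τ⁻¹ * t : ℝ) : UnitAddCircle) x) := by
  sorry

/-- **H1' (roll-up dictionary, pointwise).** The rolled-up field read at slab coordinates. -/
theorem timeRoll_cons_inv_mul {n : ℕ} {F : Type*} {τ : ℝ} (hτ : 0 < τ)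
    {u : ℝ → UnitAddTorus (Fin n) → F} (hu : Periodic u τ) (t : ℝ) (x : UnitAddTorus (Fin n)) :
    Torus.timeRoll τ u (Fin.cons ((τ⁻¹ * t : ℝ) : UnitAddCircle) x) = u t x := by
  sorry

/-- **H1'' (translations are group translations).** -/
theorem cons_add_cons {n : ℕ} (a b : UnitAddCircle) (x h : UnitAddTorus (Fin n)) :
    (Fin.cons a x : UnitAddTorus (Fin (n + 1))) + Fin.cons b h = Fin.cons (a + b) (x + h) := by
  sorry

/-- **H1''' (small circle elements have small real representatives).** -/
theorem exists_abs_le_coe_eq {τ δ : ℝ} (hτ : 0 < τ) (c : UnitAddCircle) (hc : ‖c‖ ≤ δ) :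
    ∃ s : ℝ, |s| ≤ τ * δ ∧ ((τ⁻¹ * s : ℝ) : UnitAddCircle) = c := by
  sorry

/-- **H2 (value padding `ℝ³ ↪ ℝ⁴`)**, so that the tree's Fourier toolkit (typed
`UnitAddTorus d → EuclideanSpace ℝ d`) applies on `T⁴`. -/
def pad : E³ →ₗᵢ[ℝ] EuclideanSpace ℝ (Fin 4) where
  toFun v := WithLp.toLp 2 (Fin.snoc (fun i : Fin 3 => v i) 0)
  map_add' v w := by
    sorry
  map_smul' c v := by
    sorry
  norm_map' v := by
    sorry

/-- `pad` preserves smoothness of fields on the torus. -/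
theorem isSmooth_pad_comp {d : Type*} [Fintype d] {U : UnitAddTorus d → E³} (hU : Torus.IsSmooth U) :
    Torus.IsSmooth (pad ∘ U) := by
  sorry

/-- **H3 (Kolmogorov–Riesz on `T^d`, sufficiency, Cauchy-subsequence form; the heart).**
Smooth fields bounded in `L³(T^d)` and uniformly `L³`-equicontinuous under translations have an
`L³`-Cauchy subsequence.  Fourier proof: Bolzano–Weierstrass on the modes
(`exists_strictMono_forall_tendsto`), CET mollification error ≤ translation modulus
(`Torus.eLpNorm_kernel_convolution_sub_self_le`), low/high split of the mollified difference
(`Torus.norm_kernel_convolution_apply_le`, `Torus.tendsto_tsum_compl_norm_mFourierCoeff_kernel`). -/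
theorem exists_subseq_cauchy_of_translate {d : Type*} [Fintype d] [DecidableEq d]
    (U : ℕ → UnitAddTorus d → EuclideanSpace ℝ d) (hU : ∀ n, Torus.IsSmooth (U n))
    {M : ℝ≥0∞} (hM : M ≠ ⊤) (hbd : ∀ n, ∫⁻ y, ‖U n y‖ₑ ^ 3 ≤ M)
    (hmod : ∀ η : ℝ≥0∞, 0 < η → ∃ δ : ℝ, 0 < δ ∧ ∀ (n : ℕ) (a : UnitAddTorus d), ‖a‖ ≤ δ →
        ∫⁻ y, ‖U n (y - a) - U n y‖ₑ ^ 3 ≤ η) :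
    ∃ φ : ℕ → ℕ, StrictMono φ ∧ ∀ η : ℝ≥0∞, 0 < η → ∃ N : ℕ, ∀ n m : ℕ, N ≤ n → N ≤ m →
        ∫⁻ y, ‖U (φ n) y - U (φ m) y‖ₑ ^ 3 ≤ η := by
  sorry

/-- **H3-A (same conclusion, net + equicontinuity proof, any finite-dimensional values — no padding;
PRIMARY).** -/
theorem exists_subseq_cauchy_of_translate' {d : Type*} [Fintype d]
    {F : Type*} [NormedAddCommGroup F] [NormedSpace ℝ F] [FiniteDimensional ℝ F]
    (U : ℕ → UnitAddTorus d → F) (hU : ∀ n, Continuous (U n))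
    {M : ℝ≥0∞} (hM : M ≠ ⊤) (hbd : ∀ n, ∫⁻ y, ‖U n y‖ₑ ^ 3 ≤ M)
    (hmod : ∀ η : ℝ≥0∞, 0 < η → ∃ δ : ℝ, 0 < δ ∧ ∀ (n : ℕ) (a : UnitAddTorus d), ‖a‖ ≤ δ →
        ∫⁻ y, ‖U n (y - a) - U n y‖ₑ ^ 3 ≤ η) :
    ∃ φ : ℕ → ℕ, StrictMono φ ∧ ∀ η : ℝ≥0∞, 0 < η → ∃ N : ℕ, ∀ n m : ℕ, N ≤ n → N ≤ m →
        ∫⁻ y, ‖U (φ n) y - U (φ m) y‖ₑ ^ 3 ≤ η := by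
  sorry

/-! ### Sub-helpers of H3-A (the bricks not yet in the tree) -/

section SubA

open scoped Convolution

/-- **A2 (sup bound of a mollified field by its `L¹` norm).** `‖(ρ_ε ⋆ w)(x)‖ ≤ (sup ρ_ε) ‖w‖_{L¹}`
(the pairing opposite to the tree's `Torus.norm_convolution_le`). -/
theorem norm_kernel_convolution_le_mul_integral_norm {d : Type*} [Fintype d]
    {F : Type*} [NormedAddCommGroup F] [NormedSpace ℝ F] [CompleteSpace F]
    {ε : ℝ} (hε : 0 < ε) (hε' : ε ≤ 1 / 4) {C : ℝ} (hC : ∀ y, Torus.kernel (d := d) ε y ≤ C)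
    {w : UnitAddTorus d → F} (hw : Integrable w volume) (x : UnitAddTorus d) :
    ‖(Torus.kernel ε ⋆ w) x‖ ≤ C * ∫ y, ‖w y‖ := by
  sorry

/-- **A3 (translates of a mollification = mollification of the translate)**; with A2 and
`‖·‖_{L¹} ≤ ‖·‖_{L³}` this makes `{ρ_ε ⋆ U n}` uniformly equicontinuous from the translation
modulus ALONE (no derivative of the kernel). -/
theorem kernel_convolution_sub_apply {d : Type*} [Fintype d]
    {F : Type*} [NormedAddCommGroup F] [NormedSpace ℝ F] [CompleteSpace F]
    {ε : ℝ} (hε : 0 < ε) (hε' : ε ≤ 1 / 4) {w : UnitAddTorus d → F} (hw : Integrable w volume)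
    (x a : UnitAddTorus d) :
    (Torus.kernel ε ⋆ w) (x - a) - (Torus.kernel ε ⋆ w) x =
      (Torus.kernel ε ⋆ fun y => w (y - a) - w y) x := by
  sorry

/-- **A4 (sup-Cauchy of the mollified differences along ONE subsequence, every scale `ε_k = 1/(k+4)`)**:
diagonal extraction over `ℕ × Q`, `Q` countable dense (`exists_strictMono_forall_tendsto`), then a
finite `δ`-net + A2/A3 equicontinuity (the `hCauchy` block of the tree's
`exists_subseq_tendstoUniformlyOn_of_equicontinuous`). -/
theorem exists_subseq_forall_kernel_convolution_sub_le {d : Type*} [Fintype d]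
    {F : Type*} [NormedAddCommGroup F] [NormedSpace ℝ F] [FiniteDimensional ℝ F]
    (U : ℕ → UnitAddTorus d → F) (hU : ∀ n, Continuous (U n))
    {R : ℝ} (hbd : ∀ n, ∫ y, ‖U n y‖ ≤ R)
    (hmod : ∀ η : ℝ, 0 < η → ∃ δ : ℝ, 0 < δ ∧ ∀ (n : ℕ) (a : UnitAddTorus d), ‖a‖ ≤ δ →
        ∫ y, ‖U n (y - a) - U n y‖ ≤ η) :
    ∃ φ : ℕ → ℕ, StrictMono φ ∧ ∀ (k : ℕ) (η : ℝ), 0 < η → ∃ N : ℕ, ∀ n m : ℕ, N ≤ n → N ≤ m →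
      ∀ x, ‖(Torus.kernel (1 / ((k : ℝ) + 4)) ⋆ U (φ n)) x -
        (Torus.kernel (1 / ((k : ℝ) + 4)) ⋆ U (φ m)) x‖ ≤ η := by
  haveI : CompleteSpace F := FiniteDimensional.complete ℝ F
  sorry

end SubA

/-- **H2' (value un-padding `ℝ⁴ → ℝ³`, for the Fourier variant 1F).** -/
def unpad (z : EuclideanSpace ℝ (Fin 4)) : E³ := WithLp.toLp 2 fun i : Fin 3 => z (Fin.castSucc i)

theorem unpad_pad (v : E³) : unpad (pad v) = v := by
  sorry

theorem norm_unpad_sub_unpad_le (z z' : EuclideanSpace ℝ (Fin 4)) : ‖unpad z - unpad z'‖ ≤ ‖z - z'‖ := by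
  sorry

theorem continuous_unpad : Continuous unpad := by
  sorry

/-- **H4 (completeness of `L³(T^d)`, representative).** -/
theorem exists_limit_of_cauchy {d ι : Type*} [Fintype d] [Fintype ι]
    (U : ℕ → UnitAddTorus d → EuclideanSpace ℝ ι) (hU : ∀ n, AEStronglyMeasurable (U n) volume)
    (hfin : ∀ n, ∫⁻ y, ‖U n y‖ₑ ^ 3 ≠ ⊤)
    (hC : ∀ η : ℝ≥0∞, 0 < η → ∃ N : ℕ, ∀ n m : ℕ, N ≤ n → N ≤ m →
        ∫⁻ y, ‖U n y - U m y‖ₑ ^ 3 ≤ η) :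
    ∃ W : UnitAddTorus d → EuclideanSpace ℝ ι, StronglyMeasurable W ∧ ∫⁻ y, ‖W y‖ₑ ^ 3 ≠ ⊤ ∧
      Tendsto (fun n => ∫⁻ y, ‖U n y - W y‖ₑ ^ 3) atTop (𝓝 0) := by
  sorry

/-- **H5 (unrolling a Borel function on `T⁴` gives a `τ`-periodic field with measurable lift).** -/
theorem periodic_and_measurable_unroll {τ : ℝ} (hτ : 0 < τ) {F : Type*} [NormedAddCommGroup F]
    (W : UnitAddTorus (Fin 4) → F) (hW : StronglyMeasurable W) :
    Periodic (fun t : ℝ => fun x : 𝕋³ => W (Fin.cons ((τ⁻¹ * t : ℝ) : UnitAddCircle) x)) τ ∧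
      StronglyMeasurable (Torus.stLift fun t : ℝ => fun x : 𝕋³ =>
        W (Fin.cons ((τ⁻¹ * t : ℝ) : UnitAddCircle) x)) := by
  sorry

/-! ## Plan 2 — CONDITIONAL EXPECTATION ON GRID CELLS (Hanche-Olsen–Holden Thm 5 on the slab) -/

/-- **P2-H1 (Jensen + translation invariance: cell-average defect ≤ translation modulus).** -/
theorem sum_lintegral_sub_setAverage_le {G : Type*} [AddCommGroup G] [MeasurableSpace G]
    [TopologicalSpace G] [IsTopologicalAddGroup G] [BorelSpace G] [MeasurableAdd₂ G]
    (μ : Measure G) [μ.IsAddRightInvariant] [SFinite μ]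
    {ι : Type*} (s : Finset ι) (A : ι → Set G) (hA : ∀ i, MeasurableSet (A i))
    (hdisj : (s : Set ι).PairwiseDisjoint A)
    {m : ℝ≥0∞} (hm : ∀ i ∈ s, μ (A i) = m) (hm0 : m ≠ 0) (hm' : m ≠ ⊤)
    (D : Set G) (hD : MeasurableSet D) (hAD : ∀ i ∈ s, ∀ z ∈ A i, ∀ z' ∈ A i, z' - z ∈ D)
    {E : Type*} [NormedAddCommGroup E] [NormedSpace ℝ E] [CompleteSpace E]
    (u : G → E) (hu : AEStronglyMeasurable u μ) (hint : ∀ i ∈ s, IntegrableOn u (A i) μ)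
    {p : ℝ} (hp : 1 ≤ p) :
    ∑ i ∈ s, ∫⁻ z in A i, ‖u z - ⨍ z' in A i, u z' ∂μ‖ₑ ^ p ∂μ ≤
      μ D / m * ⨆ a ∈ D, ∫⁻ z in ⋃ i ∈ s, A i, ‖u (z + a) - u z‖ₑ ^ p ∂μ := by
  sorry

/-- **P2-H2 (approximation by totally bounded sets; Hanche-Olsen–Holden Lemma 1 /
`Metric.totallyBounded_of_finite_discretization`).** -/
theorem totallyBounded_of_approx {α : Type*} [PseudoMetricSpace α] {s : Set α}
    (h : ∀ ε > (0 : ℝ), ∃ t : Set α, TotallyBounded t ∧ ∀ x ∈ s, ∃ y ∈ t, dist x y ≤ ε) :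
    TotallyBounded s := by
  sorry

/-- **P2-H3 (extraction from a totally bounded sequence in a complete space).** -/
theorem exists_subseq_tendsto_of_totallyBounded {α : Type*} [PseudoMetricSpace α] [CompleteSpace α]
    (x : ℕ → α) (hx : TotallyBounded (range x)) :
    ∃ (a : α) (φ : ℕ → ℕ), StrictMono φ ∧ Tendsto (x ∘ φ) atTop (𝓝 a) := by
  sorry

/-- **P2-H4 (periodic extension from the window by the tree's `timePeriodize 0 τ = (· ∘ timeWrap 0 τ)`
(= `toIcoMod`, `timeWrap_eq_toIcoMod`); measurability of the lift via `timeWrap_def` +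
`Int.measurable_floor`).** The first two conjuncts are `periodic_timePeriodize` /
`timePeriodize_eq_self`; only the third is new. -/
theorem periodic_and_measurable_timePeriodize {τ : ℝ} (hτ : 0 < τ) {F : Type*} [NormedAddCommGroup F]
    (W : ℝ × 𝕋³ → F) (hW : StronglyMeasurable W) :
    Periodic (timePeriodize 0 τ (Function.curry W)) τ ∧
      (∀ t ∈ Ico 0 τ, timePeriodize 0 τ (Function.curry W) t = Function.curry W t) ∧
      StronglyMeasurable (Torus.stLift (timePeriodize 0 τ (Function.curry W))) := by
  sorry

end Summit.AnomalousDissipation.AnomalousDissipation.Cruxes.EulerlimitThesisV2.Tight.StubIdeas2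

end
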